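import Literature.RingTheory.Henselian.FiniteAlgebraProductOfLocalizations
import Literature.AlgebraicGeometry.Morphisms.AffinePointsOverSpec
import Mathlib.AlgebraicGeometry.Morphisms.Finite
import Mathlib.AlgebraicGeometry.Morphisms.ClosedImmersion
import Mathlib.CategoryTheory.Monoidal.Cartesian.Over
import Mathlib.CategoryTheory.Monoidal.Cartesian.Grp
import Mathlib.RingTheory.Ideal.GoingUp
import HarnessLib

/-!
# The unit component of a finite group scheme over a henselian local ring is the kernel of the reduction map on local points
# ([Tate1997FiniteFlatGroupSchemes] (3.7); [SerreTate1968] §1 Lemma 1; [StacksProject] Tag 04GG)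

Topic `Literature/AlgebraicGeometry/GroupSchemes`, namespace `Literature.AlgebraicGeometry.GroupSchemes.UnitComponent`.  THEOREMS ONLY (no
definition, no named fact, no instance, no notation, no `sorry`).  Generic form of `stub_b1b_kernelOfReduction` of the organ sub-line
`Cruxes/HLiu418/Lines/F0_P6b_ConnectedEtale.lean` ED. 1 (cell `pub/hodgecm-mathlib`, P6 «MOD», HEART input (b1)); the line's `IsUnitComponent G G₀ j`
is UNBUNDLED here into its four clauses (`IsMonHom j`, `IsOpenImmersion j.left`, `IsClosedImmersion j.left`, `ConnectedSpace G₀.left`) so that no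
`Cruxes/…/Lines` module is imported; generic capital `--supports stmt-HodgeConjecture-24832`.  HONEST LABEL: HC_CM is proved only modulo the cell's 2
remaining named inputs (hLiu418 24832, h413 24833) until rung 0 closes; this file pays no letter.

THE MATHEMATICS.  `R` henselian local, `G → Spec R` a FINITE group scheme, `j : G₀ ↪ G` an open-and-closed sub-group-scheme with CONNECTED `G₀`
(the unit component, [Tate1997FiniteFlatGroupSchemes] (3.7) (I)); `R′` local, `f : R → R′` a local homomorphism, `t : Spec R′ → G` over `Spec R`.
CLAIM: `t` factors through `G₀` iff its reduction `Spec κ(R′) → G` is the unit `κ(R′)`-point.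
(⇐) needs only `j` OPEN: the open `t⁻¹(G₀) ⊆ Spec R′` contains the closed point, hence is everything (Mathlib `IsLocalRing.closed_point_mem_iff`,
`IsOpenImmersion.lift`).  (⇒) `G₀ = Spec B₀` is affine and finite over `R`, and CONNECTED, so — `R` being henselian — `B₀` is LOCAL
(`isLocalRing_of_connectedSpace`: ★ `Henselian.exists_completeOrthogonalIdempotents_isLocalRing` [StacksProject 04GG (10)] + «an idempotent of a
connected spectrum is `0` or `1`», Mathlib `PrimeSpectrum.isIdempotentElemEquivClopens`); a ring map `ψ : B₀ → κ(R′)` under `res ∘ f : R → κ(R′)`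
has prime kernel over `𝔪_R`, hence maximal (`B₀` integral over `R`, Mathlib `Ideal.isMaximal_of_isIntegral_of_isMaximal_comap`), hence `= 𝔪_{B₀}`,
and `B₀ = R·1 + ker(ε₀)` for the unit's retraction `ε₀ : B₀ → R` with `ker ε₀ ⊆ 𝔪_{B₀}` — so `ψ` is UNIQUE (`ringHom_eq_of_retraction`); the two
`κ(R′)`-points «reduction of `s`» and «unit» of `G₀` therefore coincide (points dictionary ★ `Morphisms/AffinePointsOverSpec`, [StacksProject] 01I1).
HENSELIAN is needed for (⇒) (over a non-henselian local base a connected finite `G₀` may have a disconnected special fibre); LOCAL `R′`∕`f` are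
needed (a non-local point can straddle components) — the line card's A4 notes.

* §1 `ringHom_eq_of_retraction` (algebra), §2 `eq_zero_or_eq_one_of_isIdempotentElem`, `isLocalRing_of_connectedSpace` (algebra + 04GG),
* §3 `finite_structureRingHom`, **`exists_factor_iff_reduction_eq_unit`** (the head, universe-polymorphic).

## References
* [Tate1997FiniteFlatGroupSchemes] J. Tate, *Finite flat group schemes*, in: Modular Forms and Fermat's Last Theorem (1997), (3.7) (connected–étale
  sequence over a henselian local base; `G⁰ = Spec` of the local factor at the unit).
* [SerreTate1968] J.-P. Serre, J. Tate, *Good reduction of abelian varieties*, Ann. of Math. 88 (1968), §1 Lemma 1.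
* [StacksProject] The Stacks Project, Tag 04GG (finite algebras over henselian local rings), Tag 00EE (idempotents ↔ clopens), Tag 01I1.
-/

set_option autoImplicit false

noncomputable section

universe u

open CategoryTheory AlgebraicGeometry IsLocalRing MonoidalCategory CartesianMonoidalCategory
open scoped MonObj

namespace Literature.AlgebraicGeometry.GroupSchemes.UnitComponent

/-! ### §1 Algebra: ring maps to a field from a local integral algebra with a retraction are determined on the base -/

/-- **Uniqueness of field-valued points of a local finite algebra with a section.**  `R` local, `S` a LOCAL `R`-algebra integral over `R` with an
`R`-algebra retraction `ε : S → R`; `g : R → K` a ring map to a field with `ker g = 𝔪_R`.  Then any two ring maps `ψ₁ ψ₂ : S → K` under `g` are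
equal: `ker ψᵢ` is a prime over `𝔪_R`, hence maximal (integrality), hence `𝔪_S ⊇ ker ε`, and `b ≡ ε(b)·1 (mod ker ε)`.
[cite: StacksProject, Tag 04GG] [cite: Tate1997FiniteFlatGroupSchemes, (3.7)] -/
theorem ringHom_eq_of_retraction {R S K : Type*} [CommRing R] [IsLocalRing R] [CommRing S] [IsLocalRing S] [Algebra R S]
    [Algebra.IsIntegral R S] (ε : S →ₐ[R] R) [Field K] (g : R →+* K) (hg : RingHom.ker g = maximalIdeal R)
    (ψ₁ ψ₂ : S →+* K) (h₁ : ψ₁.comp (algebraMap R S) = g) (h₂ : ψ₂.comp (algebraMap R S) = g) : ψ₁ = ψ₂ := by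
  have key : ∀ ψ : S →+* K, ψ.comp (algebraMap R S) = g → ∀ b, ψ b = g (ε b) := by
    intro ψ hψ b
    haveI : (RingHom.ker ψ).IsPrime := RingHom.ker_isPrime ψ
    have hmax : (RingHom.ker ψ).IsMaximal := by
      refine Ideal.isMaximal_of_isIntegral_of_isMaximal_comap (R := R) _ ?_
      rw [RingHom.comap_ker, hψ, hg]
      exact IsLocalRing.maximalIdeal.isMaximal R
    have hker : RingHom.ker ψ = maximalIdeal S := IsLocalRing.eq_maximalIdeal hmax
    have hε : b - algebraMap R S (ε b) ∈ RingHom.ker ψ := by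
      rw [hker]
      refine IsLocalRing.le_maximalIdeal (RingHom.ker_ne_top (ε : S →+* R)) ?_
      rw [RingHom.mem_ker, map_sub, RingHom.coe_coe, AlgHom.commutes, Algebra.algebraMap_self_apply, sub_self]
    rw [RingHom.mem_ker, map_sub, sub_eq_zero] at hε
    rw [hε, ← RingHom.comp_apply, hψ]
  ext b
  rw [key ψ₁ h₁, key ψ₂ h₂]

/-! ### §2 A finite algebra with connected spectrum over a henselian local ring is local -/

/-- An idempotent of a ring with CONNECTED spectrum is `0` or `1` (clopens ↔ idempotents, [StacksProject] Tag 00EE; Mathlib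
`PrimeSpectrum.isIdempotentElemEquivClopens`). [cite: StacksProject, Tag 00EE] -/
theorem eq_zero_or_eq_one_of_isIdempotentElem {S : Type*} [CommRing S] [ConnectedSpace (PrimeSpectrum S)] {e : S}
    (he : IsIdempotentElem e) : e = 0 ∨ e = 1 := by
  set c := PrimeSpectrum.isIdempotentElemEquivClopens (R := S) ⟨e, he⟩ with hc
  have hce : (PrimeSpectrum.isIdempotentElemEquivClopens (R := S)).symm c = ⟨e, he⟩ := by
    rw [hc, OrderIso.symm_apply_apply]
  rcases isClopen_iff.mp c.isClopen with h | h
  · left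
    have hbot : c = ⊥ := TopologicalSpace.Clopens.ext h
    rw [hbot, PrimeSpectrum.isIdempotentElemEquivClopens_symm_bot] at hce
    exact (congrArg Subtype.val hce).symm
  · right
    have htop : c = ⊤ := TopologicalSpace.Clopens.ext h
    rw [htop, PrimeSpectrum.isIdempotentElemEquivClopens_symm_top] at hce
    exact (congrArg Subtype.val hce).symm

/-- **A module-finite algebra with connected spectrum over a henselian local ring is local** ([StacksProject] Tag 04GG (10): it is a finite product
of local rings, ★ `Henselian.exists_completeOrthogonalIdempotents_isLocalRing`, and connectedness leaves one factor). [cite: StacksProject, Tag 04GG] -/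
theorem isLocalRing_of_connectedSpace (R : Type u) [CommRing R] [HenselianLocalRing R] {S : Type u} [CommRing S] [Algebra R S]
    [Module.Finite R S] [ConnectedSpace (PrimeSpectrum S)] : IsLocalRing S := by
  haveI : Nontrivial S := by
    by_contra h
    rw [not_nontrivial_iff_subsingleton] at h
    exact (inferInstance : Nonempty (PrimeSpectrum S)).elim fun x => x.2.ne_top (Subsingleton.elim _ _)
  obtain ⟨n, e, he, hloc⟩ :=
    Literature.RingTheory.Henselian.exists_completeOrthogonalIdempotents_isLocalRing R (S := S)
  obtain ⟨i, hi⟩ : ∃ i, e i = 1 := by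
    by_contra h
    have h0 : ∀ i, e i = 0 := fun i =>
      (eq_zero_or_eq_one_of_isIdempotentElem (he.idem i)).resolve_right fun hi => h ⟨i, hi⟩
    have h1 := he.complete
    simp only [h0, Finset.sum_const_zero] at h1
    exact zero_ne_one h1
  haveI := hloc i
  have hI : Ideal.span {1 - e i} = (⊥ : Ideal S) := by rw [hi, sub_self, Ideal.span_singleton_eq_bot]
  let q : (S ⧸ Ideal.span {1 - e i}) ≃+* S := (Ideal.quotEquivOfEq hI).trans (RingEquiv.quotientBot S)
  exact IsLocalRing.of_surjective' q.toRingHom q.surjective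

/-! ### §3 The head: a local point factors through the unit component iff its reduction is the unit point -/

/-- `Γ(G₀, 𝒪)` is module-finite over `R` through the structure map `(ΓSpecIso R)⁻¹ ≫ Γ(G₀ → Spec R)`, for `G₀ → Spec R` finite with `G₀` affine
(Mathlib `Scheme.Hom.finite_appTop`). [cite: StacksProject, Tag 01I1] -/
theorem finite_structureRingHom {A : CommRingCat.{u}} (G₀ : Over (Spec A)) [IsAffine G₀.left] [IsFinite G₀.hom] :
    ((Scheme.ΓSpecIso A).inv ≫ G₀.hom.appTop).hom.Finite := by
  have hbij : Function.Bijective (Scheme.ΓSpecIso A).inv.hom := ConcreteCategory.bijective_of_isIso (Scheme.ΓSpecIso A).inv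
  rw [CommRingCat.hom_comp]
  exact RingHom.Finite.comp (Scheme.Hom.finite_appTop G₀.hom) (RingHom.Finite.of_surjective _ hbij.2)

/-- **The unit component is the kernel of reduction on local points** ([Tate1997FiniteFlatGroupSchemes] (3.7); [SerreTate1968] §1 Lemma 1).
`R` henselian local; `G` a finite group scheme over `Spec R`; `j : G₀ ⟶ G` a homomorphism which is an open and closed immersion with `G₀`
connected; `R′` local, `f : R → R′` local, `t : Spec R′ → G` over `Spec R`.  Then `(∃ s, s ≫ j = t) ↔ Spec (res R′) ≫ t = Spec (res R′ ∘ f) ≫ e_G`.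
[cite: Tate1997FiniteFlatGroupSchemes, (3.7)] [cite: SerreTate1968, §1 Lemma 1] [cite: StacksProject, Tag 04GG] -/
theorem exists_factor_iff_reduction_eq_unit (R : Type u) [CommRing R] [HenselianLocalRing R] (G G₀ : Over (Spec (CommRingCat.of R)))
    [GrpObj G] [GrpObj G₀] (j : G₀ ⟶ G) [IsMonHom j] [IsOpenImmersion j.left] [IsClosedImmersion j.left] [ConnectedSpace G₀.left]
    [IsFinite G.hom] (R' : Type u) [CommRing R'] [IsLocalRing R'] (f : R →+* R') [IsLocalHom f]
    (t : Spec (CommRingCat.of R') ⟶ G.left) (ht : t ≫ G.hom = Spec.map (CommRingCat.ofHom f)) :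
    (∃ s : Spec (CommRingCat.of R') ⟶ G₀.left, s ≫ j.left = t) ↔
      Spec.map (CommRingCat.ofHom (residue R')) ≫ t =
        Spec.map (CommRingCat.ofHom ((residue R').comp f)) ≫ (η[G] : 𝟙_ _ ⟶ G).left := by
  have hηj : (η[G₀] : 𝟙_ _ ⟶ G₀).left ≫ j.left = (η[G] : 𝟙_ _ ⟶ G).left := by
    rw [← Over.comp_left, IsMonHom.one_hom j]
  have hres : Spec.map (CommRingCat.ofHom ((residue R').comp f)) =
      Spec.map (CommRingCat.ofHom (residue R')) ≫ Spec.map (CommRingCat.ofHom f) := by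
    rw [← Spec.map_comp, ← CommRingCat.ofHom_comp]
  constructor
  · -- (⇒): `G₀` is the spectrum of a LOCAL finite `R`-algebra, on which field-valued points under `res ∘ f` are unique
    rintro ⟨s, rfl⟩
    have ht' : s ≫ j.left ≫ G.hom = Spec.map (CommRingCat.ofHom f) := by simpa only [Category.assoc] using ht
    haveI : IsAffine G.left := isAffine_of_isAffineHom G.hom
    haveI : IsAffine G₀.left := isAffine_of_isAffineHom j.left
    haveI : IsFinite G₀.hom := by
      rw [← Over.w j]
      exact MorphismProperty.comp_mem _ _ _ inferInstance inferInstance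
    set φ₀ : CommRingCat.of R ⟶ Γ(G₀.left, ⊤) := (Scheme.ΓSpecIso (.of R)).inv ≫ G₀.hom.appTop with hφ₀
    letI : Algebra R Γ(G₀.left, ⊤) := φ₀.hom.toAlgebra
    haveI : Module.Finite R Γ(G₀.left, ⊤) := finite_structureRingHom G₀
    haveI : Algebra.IsIntegral R Γ(G₀.left, ⊤) := Algebra.IsIntegral.of_finite R _
    -- connected ⇒ local
    haveI : ConnectedSpace (PrimeSpectrum Γ(G₀.left, ⊤)) :=
      Function.Surjective.connectedSpace (f := G₀.left.isoSpec.hom.base)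
        (ConcreteCategory.bijective_of_isIso G₀.left.isoSpec.hom.base).2 G₀.left.isoSpec.hom.base.hom.continuous
    haveI : IsLocalRing Γ(G₀.left, ⊤) := isLocalRing_of_connectedSpace R
    -- the retraction of the unit section
    have hη₀ : (η[G₀] : 𝟙_ _ ⟶ G₀).left ≫ G₀.hom = 𝟙 (Spec (CommRingCat.of R)) := Over.w (η[G₀] : 𝟙_ _ ⟶ G₀)
    have hε := (Literature.AlgebraicGeometry.Morphisms.comp_eq_specMap_iff G₀.hom (𝟙 (CommRingCat.of R))
      (η[G₀] : 𝟙_ _ ⟶ G₀).left).mp (by rw [Spec.map_id]; exact hη₀)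
    let ε₀ : Γ(G₀.left, ⊤) →ₐ[R] R :=
      { ((η[G₀] : 𝟙_ _ ⟶ G₀).left.appTop ≫ (Scheme.ΓSpecIso (.of R)).hom).hom with
        commutes' := fun r => by
          have h := congrArg (fun g : CommRingCat.of R ⟶ CommRingCat.of R => g.hom r) hε
          simp only [CommRingCat.hom_comp, CommRingCat.hom_id, RingHom.comp_apply, RingHom.id_apply] at h
          change ((Scheme.ΓSpecIso (.of R)).hom).hom (((η[G₀] : 𝟙_ _ ⟶ G₀).left.appTop).hom (algebraMap R _ r)) =
            algebraMap R R r
          rw [RingHom.algebraMap_toAlgebra, Algebra.algebraMap_self_apply]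
          exact h }
    -- the two `κ(R′)`-points of `G₀`: the reduction of `s`, and the unit; both lie over `res ∘ f`
    have hxw : (Spec.map (CommRingCat.ofHom (residue R')) ≫ s) ≫ G₀.hom =
        Spec.map (CommRingCat.ofHom ((residue R').comp f)) := by
      rw [Category.assoc, ← Over.w j, ht', hres]
    have hyw : (Spec.map (CommRingCat.ofHom ((residue R').comp f)) ≫ (η[G₀] : 𝟙_ _ ⟶ G₀).left) ≫ G₀.hom =
        Spec.map (CommRingCat.ofHom ((residue R').comp f)) := by
      rw [Category.assoc]
      exact (congrArg (Spec.map (CommRingCat.ofHom ((residue R').comp f)) ≫ ·) hη₀).trans (Category.comp_id _)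
    have hg : RingHom.ker ((residue R').comp f) = maximalIdeal R := by
      rw [← RingHom.comap_ker, IsLocalRing.ker_residue, IsLocalRing.maximalIdeal_comap]
    have chart : ∀ z : Spec (CommRingCat.of (ResidueField R')) ⟶ G₀.left,
        z ≫ G₀.hom = Spec.map (CommRingCat.ofHom ((residue R').comp f)) →
          (z.appTop ≫ (Scheme.ΓSpecIso (.of (ResidueField R'))).hom).hom.comp (algebraMap R Γ(G₀.left, ⊤)) =
            (residue R').comp f := by
      intro z hz
      have h := (Literature.AlgebraicGeometry.Morphisms.comp_eq_specMap_iff G₀.hom _ z).mp hz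
      have h' := congrArg CommRingCat.Hom.hom h
      simp only [CommRingCat.hom_comp, CommRingCat.hom_ofHom] at h'
      rw [RingHom.algebraMap_toAlgebra, hφ₀, CommRingCat.hom_comp, CommRingCat.hom_comp]
      exact h'
    have hxy : Spec.map (CommRingCat.ofHom (residue R')) ≫ s =
        Spec.map (CommRingCat.ofHom ((residue R').comp f)) ≫ (η[G₀] : 𝟙_ _ ⟶ G₀).left := by
      apply Literature.AlgebraicGeometry.Morphisms.bijective_appTop_comp_ΓSpecIso_hom.1
      apply CommRingCat.hom_ext
      exact ringHom_eq_of_retraction ε₀ ((residue R').comp f) hg _ _ (chart _ hxw) (chart _ hyw)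
    calc Spec.map (CommRingCat.ofHom (residue R')) ≫ s ≫ j.left
        = (Spec.map (CommRingCat.ofHom (residue R')) ≫ s) ≫ j.left := (Category.assoc _ _ _).symm
      _ = (Spec.map (CommRingCat.ofHom ((residue R').comp f)) ≫ (η[G₀] : 𝟙_ _ ⟶ G₀).left) ≫ j.left := by rw [hxy]
      _ = Spec.map (CommRingCat.ofHom ((residue R').comp f)) ≫ (η[G] : 𝟙_ _ ⟶ G).left := by
        rw [Category.assoc]
        exact congrArg (Spec.map (CommRingCat.ofHom ((residue R').comp f)) ≫ ·) hηj
  · -- (⇐): the open `t⁻¹(G₀)` contains the closed point of the local scheme `Spec R′`, hence is everything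
    intro hred
    have hpt : (Spec.map (CommRingCat.ofHom (residue R'))) (closedPoint (ResidueField R')) = closedPoint R' :=
      PrimeSpectrum.comap_residue R' _
    have hmem : t (closedPoint R') ∈ j.left.opensRange := by
      rw [← hpt, ← Scheme.Hom.comp_apply, hred]
      refine ⟨(Spec.map (CommRingCat.ofHom ((residue R').comp f)) ≫ (η[G₀] : 𝟙_ _ ⟶ G₀).left) (closedPoint _), ?_⟩
      rw [← Scheme.Hom.comp_apply, Category.assoc]
      exact congrArg (fun k => (Spec.map (CommRingCat.ofHom ((residue R').comp f)) ≫ k) (closedPoint (ResidueField R')))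
        hηj
    have htop : t ⁻¹ᵁ j.left.opensRange = ⊤ := IsLocalRing.closed_point_mem_iff.mp hmem
    have hrange : Set.range t.base ⊆ Set.range j.left.base := by
      rintro _ ⟨x, rfl⟩
      have hx : x ∈ t ⁻¹ᵁ j.left.opensRange := by rw [htop]; trivial
      exact hx
    exact ⟨IsOpenImmersion.lift j.left t hrange, IsOpenImmersion.lift_fac j.left t hrange⟩

end Literature.AlgebraicGeometry.GroupSchemes.UnitComponent

end
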